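import Mathlib.Analysis.SpecialFunctions.SmoothTransition
import Mathlib.Analysis.SpecialFunctions.Sqrt
import Mathlib.Analysis.SpecialFunctions.ExpDeriv
import Mathlib.Analysis.InnerProductSpace.Calculus
import Mathlib.Analysis.InnerProductSpace.PiL2
import Mathlib.Analysis.Calculus.Deriv.Slope
import Mathlib.Analysis.Calculus.Deriv.Prod
import Mathlib.Analysis.Calculus.FDeriv.Mul
import HarnessLib

/-!
# The weight of the local energy method on truncated cones

Support file for `HyperbolicConeEnergy.lean` (the energy method for symmetric hyperbolic
systems on space-like truncated cones [Racke2015, Thm 3.1], [John1982, Ch. 5 §3],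
[Rendall2008, §8.3 (8.28)]). Instead of integrating the energy identity over a cone with the
divergence theorem (not available in Mathlib), the tree's proof integrates it over the whole
space against the smooth weight

  `W(t, x) = ψ_η(g(x) + c (t - t₂)) · e^{-M t}`, `g(x) = (‖x - x₂‖² + η²)^{1/2}`,

where `ψ_η(s) = smoothTransition (2 - s/η)` is a smooth non-increasing cutoff equal to `1` for
`s ≤ η` and to `0` for `s ≥ 2η`, `c` is the propagation speed and `e^{-Mt}` is Rendall's
exponential weight [Rendall2008, §8.3 (8.28)] absorbing the zeroth-order terms (Gårding's trick;
Racke uses Gronwall instead [Racke2015, Thm 3.1]). The level sets of `g(x) + ct` are the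
hyperboloidal space-like hypersurfaces of [Rendall2008, §8.3, p. 146] (`φ(x) = t₀ - (τ² +
|x - x₀|²)^{1/2}`); `g` is smooth (unlike `‖x - x₂‖`) with `‖∇g‖ ≤ 1`.

## Contents (all elementary, all proved)

* `coneCutoff η` and its properties (`nonneg`, `le_one`, `eq_zero`, `self`, antitone,
  `deriv ≤ 0`, smooth);
* `hypDist x₂ η` (= `g`): positivity, `‖x - x₂‖ < g(x)`, smoothness, the derivative along lines
  `∂ᵥ g = ⟪x - x₂, v⟫ / g`;
* `coneWeight x₂ η c t₂ M` (= `W`): smoothness, `0 ≤ W ≤ …`, the support bound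
  `W(t, x) ≠ 0 → ‖x - x₂‖ < 2η + c (t₂ - t)`, `W(t₂, x₂) = e^{-Mt₂}`, and the two partial
  derivatives `∂ₜW = (c ψ' - M ψ) e^{-Mt}`, `∂ᵥW = ψ' (⟪x - x₂, v⟫/g) e^{-Mt}`
  (`fderiv_coneWeight_time`, `fderiv_coneWeight_space`);
* two bookkeeping lemmas `fderiv_apply_one_zero`, `fderiv_apply_zero_left` computing
  `Df(t,x)(1,0)` and `Df(t,x)(0,v)` from derivatives along the coordinate lines.

## References

* [Racke2015] R. Racke, *Lectures on Nonlinear Evolution Equations*, 2nd ed., Ch. 3 Thm 3.1.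
* [John1982] F. John, *Partial Differential Equations*, 4th ed., Ch. 5 §3.
* [Rendall2008] A. Rendall, *Partial Differential Equations in General Relativity*, §8.3.
-/

noncomputable section

open Set Filter Real
open scoped InnerProductSpace

namespace Literature.Analysis.FluidPDE

/-! ### The cutoff `ψ_η` -/

/-- The smooth non-increasing cutoff `ψ_η(s) = smoothTransition (2 - s/η)`: for `η > 0` it
equals `1` on `(-∞, η]` and `0` on `[2η, ∞)`. [folklore] -/
def coneCutoff (η s : ℝ) : ℝ := Real.smoothTransition (2 - s / η)

/-- `0 ≤ ψ_η`. [folklore] -/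
theorem coneCutoff_nonneg (η s : ℝ) : 0 ≤ coneCutoff η s := Real.smoothTransition.nonneg _

/-- `ψ_η ≤ 1`. [folklore] -/
theorem coneCutoff_le_one (η s : ℝ) : coneCutoff η s ≤ 1 := Real.smoothTransition.le_one _

/-- `ψ_η(s) = 0` for `s ≥ 2η`. [folklore] -/
theorem coneCutoff_eq_zero {η s : ℝ} (hη : 0 < η) (hs : 2 * η ≤ s) : coneCutoff η s = 0 := by
  refine Real.smoothTransition.zero_of_nonpos ?_
  have : 2 ≤ s / η := by rwa [le_div_iff₀ hη]
  linarith

/-- `ψ_η(η) = 1`. [folklore] -/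
theorem coneCutoff_self {η : ℝ} (hη : η ≠ 0) : coneCutoff η η = 1 := by
  rw [coneCutoff, div_self hη]
  exact Real.smoothTransition.one_of_one_le (by norm_num)

/-- Where `ψ_η` does not vanish, the argument is `< 2η`. [folklore] -/
theorem lt_of_coneCutoff_ne_zero {η s : ℝ} (hη : 0 < η) (h : coneCutoff η s ≠ 0) : s < 2 * η := by
  by_contra hs
  exact h (coneCutoff_eq_zero hη (not_lt.1 hs))

/-- `ψ_η` is non-increasing (`η > 0`). [folklore] -/
theorem coneCutoff_antitone {η : ℝ} (hη : 0 < η) : Antitone (coneCutoff η) := by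
  intro a b hab
  refine Real.smoothTransition.monotone ?_
  have : a / η ≤ b / η := div_le_div_of_nonneg_right hab hη.le
  linarith

/-- `ψ_η` is smooth. [folklore] -/
theorem contDiff_coneCutoff (η : ℝ) {n : ℕ∞} : ContDiff ℝ n (coneCutoff η) :=
  Real.smoothTransition.contDiff.comp (contDiff_const.sub (contDiff_id.div_const η))

/-- `ψ_η` is differentiable. [folklore] -/
theorem differentiable_coneCutoff (η : ℝ) : Differentiable ℝ (coneCutoff η) :=
  (contDiff_coneCutoff η (n := 1)).differentiable one_ne_zero

/-- `ψ_η' ≤ 0` (`η > 0`). [folklore] -/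
theorem deriv_coneCutoff_nonpos {η : ℝ} (hη : 0 < η) (s : ℝ) : deriv (coneCutoff η) s ≤ 0 :=
  (coneCutoff_antitone hη).deriv_nonpos

/-! ### The hyperboloidal distance `g(x) = (‖x - x₂‖² + η²)^{1/2}` -/

variable {d : ℕ}

/-- `g(x) = (‖x - x₂‖² + η²)^{1/2}`, a smooth majorant of `‖x - x₂‖` with gradient of norm
`≤ 1` [Rendall2008, §8.3 p. 146]. [folklore] -/
def hypDist (x₂ : EuclideanSpace ℝ (Fin d)) (η : ℝ) (x : EuclideanSpace ℝ (Fin d)) : ℝ :=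
  √(‖x - x₂‖ ^ 2 + η ^ 2)

/-- The radicand of `g` is positive (`η ≠ 0`). [folklore] -/
theorem hypDist_radicand_pos {x₂ : EuclideanSpace ℝ (Fin d)} {η : ℝ} (hη : η ≠ 0)
    (x : EuclideanSpace ℝ (Fin d)) : 0 < ‖x - x₂‖ ^ 2 + η ^ 2 := by
  have : 0 < η ^ 2 := by positivity
  positivity

/-- `g > 0` (`η ≠ 0`). [folklore] -/
theorem hypDist_pos {x₂ : EuclideanSpace ℝ (Fin d)} {η : ℝ} (hη : η ≠ 0)
    (x : EuclideanSpace ℝ (Fin d)) : 0 < hypDist x₂ η x :=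
  Real.sqrt_pos.2 (hypDist_radicand_pos hη x)

/-- `‖x - x₂‖ ≤ g(x)`. [folklore] -/
theorem norm_sub_le_hypDist (x₂ : EuclideanSpace ℝ (Fin d)) (η : ℝ) (x : EuclideanSpace ℝ (Fin d)) :
    ‖x - x₂‖ ≤ hypDist x₂ η x := by
  rw [hypDist, ← Real.sqrt_sq (norm_nonneg (x - x₂))]
  exact Real.sqrt_le_sqrt (by rw [Real.sq_sqrt (sq_nonneg _)]; nlinarith [sq_nonneg η])

/-- `‖x - x₂‖ < g(x)` (`η ≠ 0`). [folklore] -/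
theorem norm_sub_lt_hypDist {x₂ : EuclideanSpace ℝ (Fin d)} {η : ℝ} (hη : η ≠ 0)
    (x : EuclideanSpace ℝ (Fin d)) : ‖x - x₂‖ < hypDist x₂ η x := by
  rw [hypDist, Real.lt_sqrt (norm_nonneg _)]
  have : 0 < η ^ 2 := by positivity
  linarith

/-- `g(x₂) = η` (`η ≥ 0`). [folklore] -/
theorem hypDist_self {x₂ : EuclideanSpace ℝ (Fin d)} {η : ℝ} (hη : 0 ≤ η) :
    hypDist x₂ η x₂ = η := by
  simp [hypDist, Real.sqrt_sq hη]

/-- `g` is smooth (`η ≠ 0`). [folklore] -/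
theorem contDiff_hypDist {x₂ : EuclideanSpace ℝ (Fin d)} {η : ℝ} (hη : η ≠ 0) {n : ℕ∞} :
    ContDiff ℝ n (hypDist x₂ η) := by
  refine ContDiff.sqrt ?_ fun x => (hypDist_radicand_pos hη x).ne'
  exact ((contDiff_id.sub contDiff_const).norm_sq ℝ).add contDiff_const

/-- The derivative of `g` along the line `s ↦ x + s v`: `∂ᵥg(x) = ⟪x - x₂, v⟫ / g(x)`. [folklore] -/
theorem hasDerivAt_hypDist_line {x₂ : EuclideanSpace ℝ (Fin d)} {η : ℝ} (hη : η ≠ 0)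
    (x v : EuclideanSpace ℝ (Fin d)) :
    HasDerivAt (fun s : ℝ => hypDist x₂ η (x + s • v)) (⟪x - x₂, v⟫_ℝ / hypDist x₂ η x) 0 := by
  have h1 : HasDerivAt (fun s : ℝ => x + s • v - x₂) v 0 := by
    simpa using ((hasDerivAt_id (0 : ℝ)).smul_const v).const_add x |>.sub_const x₂
  have h2 : HasDerivAt (fun s : ℝ => ‖x + s • v - x₂‖ ^ 2 + η ^ 2) (2 * ⟪x - x₂, v⟫_ℝ) 0 := by
    simpa using h1.norm_sq.add_const (η ^ 2)
  have h3 := h2.sqrt (by simpa using (hypDist_radicand_pos hη x).ne')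
  unfold hypDist
  convert h3 using 1
  simp only [zero_smul, add_zero]
  field_simp

/-- `|∂ᵥg| ≤ ‖v‖`: the gradient of `g` has norm `≤ 1`. [folklore] -/
theorem abs_inner_div_hypDist_le {x₂ : EuclideanSpace ℝ (Fin d)} {η : ℝ} (hη : η ≠ 0)
    (x v : EuclideanSpace ℝ (Fin d)) : |⟪x - x₂, v⟫_ℝ / hypDist x₂ η x| ≤ ‖v‖ := by
  rw [abs_div, abs_of_pos (hypDist_pos hη x), div_le_iff₀ (hypDist_pos hη x)]
  calc |⟪x - x₂, v⟫_ℝ| ≤ ‖x - x₂‖ * ‖v‖ := abs_real_inner_le_norm _ _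
    _ ≤ hypDist x₂ η x * ‖v‖ :=
        mul_le_mul_of_nonneg_right (norm_sub_le_hypDist x₂ η x) (norm_nonneg v)
    _ = ‖v‖ * hypDist x₂ η x := mul_comm _ _

/-- The unit-ish vector `ν(x) = (x - x₂)/g(x)` has norm `≤ 1`. [folklore] -/
theorem norm_inv_hypDist_smul_le {x₂ : EuclideanSpace ℝ (Fin d)} {η : ℝ} (hη : η ≠ 0)
    (x : EuclideanSpace ℝ (Fin d)) : ‖(hypDist x₂ η x)⁻¹ • (x - x₂)‖ ≤ 1 := by
  rw [norm_smul, norm_inv, Real.norm_of_nonneg (hypDist_pos hη x).le,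
    inv_mul_le_iff₀ (hypDist_pos hη x), mul_one]
  exact norm_sub_le_hypDist x₂ η x

/-! ### Directional derivatives of functions of `(t, x)` -/

section LineDeriv

variable {E G : Type*} [NormedAddCommGroup E] [NormedSpace ℝ E] [NormedAddCommGroup G]
  [NormedSpace ℝ G]

/-- `Df(t, x)(1, 0)` is the derivative of `s ↦ f(s, x)` at `t`. [folklore] -/
theorem fderiv_apply_one_zero {f : ℝ × E → G} {p : ℝ × E} {D : G}
    (hf : DifferentiableAt ℝ f p) (hl : HasDerivAt (fun s : ℝ => f (s, p.2)) D p.1) :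
    fderiv ℝ f p (1, 0) = D := by
  have h1 : HasDerivAt (fun s : ℝ => ((s, p.2) : ℝ × E)) (1, 0) p.1 :=
    (hasDerivAt_id p.1).prodMk (hasDerivAt_const p.1 p.2)
  have h2 : HasDerivAt (f ∘ fun s : ℝ => ((s, p.2) : ℝ × E)) (fderiv ℝ f p (1, 0)) p.1 :=
    hf.hasFDerivAt.comp_hasDerivAt p.1 h1
  exact h2.unique hl

/-- `Df(t, x)(0, v)` is the derivative of `s ↦ f(t, x + s v)` at `0`. [folklore] -/
theorem fderiv_apply_zero_left {f : ℝ × E → G} {p : ℝ × E} {v : E} {D : G}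
    (hf : DifferentiableAt ℝ f p) (hl : HasDerivAt (fun s : ℝ => f (p.1, p.2 + s • v)) D 0) :
    fderiv ℝ f p (0, v) = D := by
  have h1 : HasDerivAt (fun s : ℝ => ((p.1, p.2 + s • v) : ℝ × E)) (0, v) 0 := by
    refine (hasDerivAt_const (0 : ℝ) p.1).prodMk ?_
    simpa using ((hasDerivAt_id (0 : ℝ)).smul_const v).const_add p.2
  have hp : ((p.1, p.2 + (0 : ℝ) • v) : ℝ × E) = p := by simp
  have h2 : HasDerivAt (f ∘ fun s : ℝ => ((p.1, p.2 + s • v) : ℝ × E))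
      (fderiv ℝ f p (0, v)) 0 := by
    have hf' : HasFDerivAt f (fderiv ℝ f p) (p.1, p.2 + (0 : ℝ) • v) := by
      rw [hp]; exact hf.hasFDerivAt
    exact hf'.comp_hasDerivAt (0 : ℝ) h1
  exact h2.unique hl

end LineDeriv

/-! ### The weight `W` -/

/-- The weight `W(t, x) = ψ_η(g(x) + c (t - t₂)) e^{-Mt}` of the energy method on the truncated
cone with vertex region around `(t₂, x₂)` and speed `c`
[Rendall2008, §8.3 (8.28) and p. 146]. [folklore] -/
def coneWeight (x₂ : EuclideanSpace ℝ (Fin d)) (η c t₂ M : ℝ) (p : ℝ × EuclideanSpace ℝ (Fin d)) :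
    ℝ :=
  coneCutoff η (hypDist x₂ η p.2 + c * (p.1 - t₂)) * Real.exp (-(M * p.1))

section Weight

variable {x₂ : EuclideanSpace ℝ (Fin d)} {η c t₂ M : ℝ}

/-- `W` is smooth (`η ≠ 0`). [folklore] -/
theorem contDiff_coneWeight (hη : η ≠ 0) {n : ℕ∞} : ContDiff ℝ n (coneWeight x₂ η c t₂ M) := by
  unfold coneWeight
  refine ((contDiff_coneCutoff η).comp ?_).mul ?_
  · exact ((contDiff_hypDist hη).comp contDiff_snd).add
      (contDiff_const.mul (contDiff_fst.sub contDiff_const))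
  · exact (contDiff_const.mul contDiff_fst).neg.exp

/-- `W` is differentiable (`η ≠ 0`). [folklore] -/
theorem differentiable_coneWeight (hη : η ≠ 0) : Differentiable ℝ (coneWeight x₂ η c t₂ M) :=
  (contDiff_coneWeight hη (n := 1)).differentiable one_ne_zero

/-- `0 ≤ W`. [folklore] -/
theorem coneWeight_nonneg (p : ℝ × EuclideanSpace ℝ (Fin d)) : 0 ≤ coneWeight x₂ η c t₂ M p :=
  mul_nonneg (coneCutoff_nonneg _ _) (Real.exp_nonneg _)

/-- `W ≤ e^{-Mt}`. [folklore] -/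
theorem coneWeight_le_exp (p : ℝ × EuclideanSpace ℝ (Fin d)) :
    coneWeight x₂ η c t₂ M p ≤ Real.exp (-(M * p.1)) :=
  mul_le_of_le_one_left (Real.exp_nonneg _) (coneCutoff_le_one _ _)

/-- **Support of the weight**: `W(t, x) ≠ 0` forces `‖x - x₂‖ < 2η + c (t₂ - t)` — the support
of `W(t, ·)` shrinks with speed `c` (`η > 0`). [folklore] -/
theorem norm_sub_lt_of_coneWeight_ne_zero (hη : 0 < η) {p : ℝ × EuclideanSpace ℝ (Fin d)}
    (h : coneWeight x₂ η c t₂ M p ≠ 0) : ‖p.2 - x₂‖ < 2 * η + c * (t₂ - p.1) := by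
  have h1 := lt_of_coneCutoff_ne_zero hη (mul_ne_zero_iff.1 h).1
  have h2 := norm_sub_lt_hypDist hη.ne' (x₂ := x₂) p.2
  linarith

/-- At the vertex point, `W(t₂, x₂) = e^{-Mt₂} > 0` (`η > 0`). [folklore] -/
theorem coneWeight_vertex (hη : 0 < η) :
    coneWeight x₂ η c t₂ M (t₂, x₂) = Real.exp (-(M * t₂)) := by
  simp [coneWeight, hypDist_self hη.le, coneCutoff_self hη.ne']

/-- The derivative of `W` along the time line:
`∂ₜW(t, x) = (c ψ'(G) - M ψ(G)) e^{-Mt}`, `G = g(x) + c (t - t₂)`. [folklore] -/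
theorem hasDerivAt_coneWeight_time (x : EuclideanSpace ℝ (Fin d)) (t : ℝ) :
    HasDerivAt (fun s : ℝ => coneWeight x₂ η c t₂ M (s, x))
      ((c * deriv (coneCutoff η) (hypDist x₂ η x + c * (t - t₂)) -
          M * coneCutoff η (hypDist x₂ η x + c * (t - t₂))) * Real.exp (-(M * t))) t := by
  have hG : HasDerivAt (fun s : ℝ => hypDist x₂ η x + c * (s - t₂)) c t := by
    simpa using ((hasDerivAt_id t).sub_const t₂).const_mul c |>.const_add (hypDist x₂ η x)
  have hψ : HasDerivAt (fun s : ℝ => coneCutoff η (hypDist x₂ η x + c * (s - t₂)))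
      (deriv (coneCutoff η) (hypDist x₂ η x + c * (t - t₂)) * c) t :=
    ((differentiable_coneCutoff η) _).hasDerivAt.comp t hG
  have hE : HasDerivAt (fun s : ℝ => Real.exp (-(M * s))) (Real.exp (-(M * t)) * -M) t := by
    simpa using ((hasDerivAt_id t).const_mul M).neg.exp
  refine (hψ.mul hE).congr_deriv ?_
  ring

/-- The derivative of `W` along a spatial line:
`∂ᵥW(t, x) = ψ'(G) (⟪x - x₂, v⟫ / g(x)) e^{-Mt}` (`η ≠ 0`). [folklore] -/
theorem hasDerivAt_coneWeight_space (hη : η ≠ 0) (t : ℝ) (x v : EuclideanSpace ℝ (Fin d)) :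
    HasDerivAt (fun s : ℝ => coneWeight x₂ η c t₂ M (t, x + s • v))
      (deriv (coneCutoff η) (hypDist x₂ η x + c * (t - t₂)) *
          (⟪x - x₂, v⟫_ℝ / hypDist x₂ η x) * Real.exp (-(M * t))) 0 := by
  have hG : HasDerivAt (fun s : ℝ => hypDist x₂ η (x + s • v) + c * (t - t₂))
      (⟪x - x₂, v⟫_ℝ / hypDist x₂ η x) 0 :=
    (hasDerivAt_hypDist_line hη x v).add_const _
  have hψ : HasDerivAt (fun s : ℝ => coneCutoff η (hypDist x₂ η (x + s • v) + c * (t - t₂)))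
      (deriv (coneCutoff η) (hypDist x₂ η (x + (0 : ℝ) • v) + c * (t - t₂)) *
        (⟪x - x₂, v⟫_ℝ / hypDist x₂ η x)) 0 :=
    ((differentiable_coneCutoff η) _).hasDerivAt.comp 0 hG
  refine (hψ.mul_const (Real.exp (-(M * t)))).congr_deriv ?_
  simp

/-- `∂ₜW` as a Fréchet derivative: `DW(t, x)(1, 0) = (c ψ' - M ψ) e^{-Mt}` (`η ≠ 0`). [folklore] -/
theorem fderiv_coneWeight_time (hη : η ≠ 0) (p : ℝ × EuclideanSpace ℝ (Fin d)) :
    fderiv ℝ (coneWeight x₂ η c t₂ M) p (1, 0) =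
      (c * deriv (coneCutoff η) (hypDist x₂ η p.2 + c * (p.1 - t₂)) -
          M * coneCutoff η (hypDist x₂ η p.2 + c * (p.1 - t₂))) * Real.exp (-(M * p.1)) :=
  fderiv_apply_one_zero (differentiable_coneWeight hη p) (hasDerivAt_coneWeight_time p.2 p.1)

/-- `∂ᵥW` as a Fréchet derivative: `DW(t, x)(0, v) = ψ' (⟪x - x₂, v⟫/g) e^{-Mt}` (`η ≠ 0`).
[folklore] -/
theorem fderiv_coneWeight_space (hη : η ≠ 0) (p : ℝ × EuclideanSpace ℝ (Fin d))
    (v : EuclideanSpace ℝ (Fin d)) :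
    fderiv ℝ (coneWeight x₂ η c t₂ M) p (0, v) =
      deriv (coneCutoff η) (hypDist x₂ η p.2 + c * (p.1 - t₂)) *
          (⟪p.2 - x₂, v⟫_ℝ / hypDist x₂ η p.2) * Real.exp (-(M * p.1)) :=
  fderiv_apply_zero_left (differentiable_coneWeight hη p) (hasDerivAt_coneWeight_space hη p.1 p.2 v)

end Weight

/-! ### The pointwise inequality of the weighted energy identity -/

section Pointwise

variable {x₂ : EuclideanSpace ℝ (Fin d)} {η c t₂ M : ℝ}

/-- **The weighted energy density is a supersolution of the transport inequality.** If at a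
point `q = (t, x)` the energy density `e ≥ 0` and fluxes `fⱼ` satisfy the bulk inequality
`∂ₜe + Σⱼ ∂ⱼfⱼ ≤ M e` and the space-like (cone) condition `|Σⱼ νⱼ fⱼ| ≤ c e` for `‖ν‖ ≤ 1`, then
for the weight `W` with the same `c, M`:
`∂ₜ(W e) + Σⱼ ∂ⱼ(W fⱼ) = W (∂ₜe + Σⱼ∂ⱼfⱼ - M e) + ψ' e^{-Mt} (c e + Σⱼ (∂ⱼg) fⱼ) ≤ 0`
(`W ≥ 0`, `ψ' ≤ 0`, `‖∇g‖ ≤ 1`). This is the integrand of [Racke2015, (3.9)–(3.11)] /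
[Rendall2008, (8.28)] with the lateral boundary term replaced by the derivative of the cutoff.
[folklore] -/
theorem fderiv_coneWeight_mul_add_sum_le (hη : 0 < η) {e : ℝ × EuclideanSpace ℝ (Fin d) → ℝ}
    {f : Fin d → ℝ × EuclideanSpace ℝ (Fin d) → ℝ} {q : ℝ × EuclideanSpace ℝ (Fin d)}
    (he : DifferentiableAt ℝ e q) (hf : ∀ j, DifferentiableAt ℝ (f j) q)
    (hbulk : fderiv ℝ e q (1, 0) + ∑ j, fderiv ℝ (f j) q (0, EuclideanSpace.single j 1) ≤ M * e q)
    (hflux : ∀ ν : EuclideanSpace ℝ (Fin d), ‖ν‖ ≤ 1 → |∑ j, ν j * f j q| ≤ c * e q) :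
    fderiv ℝ (fun p => coneWeight x₂ η c t₂ M p * e p) q (1, 0) +
      ∑ j, fderiv ℝ (fun p => coneWeight x₂ η c t₂ M p * f j p) q
        (0, EuclideanSpace.single j 1) ≤ 0 := by
  set W := coneWeight x₂ η c t₂ M with hW
  have hWd : DifferentiableAt ℝ W q := differentiable_coneWeight hη.ne' q
  -- abbreviations
  set G : ℝ := hypDist x₂ η q.2 + c * (q.1 - t₂) with hG
  set ψ : ℝ := coneCutoff η G with hψ
  set ψ' : ℝ := deriv (coneCutoff η) G with hψ'
  set Ex : ℝ := Real.exp (-(M * q.1)) with hEx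
  set g : ℝ := hypDist x₂ η q.2 with hg
  set S₁ : ℝ := ∑ j, fderiv ℝ (f j) q (0, EuclideanSpace.single j 1) with hS₁
  set S₂ : ℝ := ∑ j, (q.2 - x₂) j / g * f j q with hS₂
  have hWq : W q = ψ * Ex := rfl
  have hWt : fderiv ℝ W q (1, 0) = (c * ψ' - M * ψ) * Ex := fderiv_coneWeight_time hη.ne' q
  have hWj : ∀ j : Fin d, fderiv ℝ W q (0, EuclideanSpace.single j 1) =
      ψ' * ((q.2 - x₂) j / g) * Ex := by
    intro j
    rw [hW, fderiv_coneWeight_space hη.ne' q, EuclideanSpace.inner_single_right]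
    simp [hψ', hG, hg, hEx]
  -- product rule
  have h1 : fderiv ℝ (fun p => W p * e p) q (1, 0) =
      W q * fderiv ℝ e q (1, 0) + e q * fderiv ℝ W q (1, 0) := by
    rw [fderiv_fun_mul hWd he]; simp [smul_eq_mul]
  have h2 : ∀ j, fderiv ℝ (fun p => W p * f j p) q (0, EuclideanSpace.single j 1) =
      W q * fderiv ℝ (f j) q (0, EuclideanSpace.single j 1) +
        f j q * fderiv ℝ W q (0, EuclideanSpace.single j 1) := by
    intro j
    rw [fderiv_fun_mul hWd (hf j)]; simp [smul_eq_mul]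
  have hsum : ∑ j, fderiv ℝ (fun p => W p * f j p) q (0, EuclideanSpace.single j 1) =
      W q * S₁ + ψ' * Ex * S₂ := by
    rw [hS₁, hS₂, Finset.mul_sum, Finset.mul_sum, ← Finset.sum_add_distrib]
    refine Finset.sum_congr rfl fun j _ => ?_
    rw [h2 j, hWj j]
    ring
  -- the two signed groups
  have hA : ψ * Ex * (fderiv ℝ e q (1, 0) + S₁ - M * e q) ≤ 0 :=
    mul_nonpos_of_nonneg_of_nonpos (mul_nonneg (coneCutoff_nonneg _ _) (Real.exp_nonneg _))
      (by linarith)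
  have hB : ψ' * Ex * (c * e q + S₂) ≤ 0 := by
    have hψ'le : ψ' ≤ 0 := deriv_coneCutoff_nonpos hη _
    set ν : EuclideanSpace ℝ (Fin d) := g⁻¹ • (q.2 - x₂) with hν
    have hνn : ‖ν‖ ≤ 1 := norm_inv_hypDist_smul_le hη.ne' q.2
    have hS₂ν : S₂ = ∑ j, ν j * f j q := by
      refine Finset.sum_congr rfl fun j _ => ?_
      simp [hν, div_eq_inv_mul, mul_comm]
    have hfl := hflux ν hνn
    rw [← hS₂ν, abs_le] at hfl
    have hpos : 0 ≤ c * e q + S₂ := by linarith [hfl.1]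
    exact mul_nonpos_of_nonpos_of_nonneg (mul_nonpos_of_nonpos_of_nonneg hψ'le (Real.exp_nonneg _))
      hpos
  calc fderiv ℝ (fun p => W p * e p) q (1, 0) +
        ∑ j, fderiv ℝ (fun p => W p * f j p) q (0, EuclideanSpace.single j 1)
      = ψ * Ex * (fderiv ℝ e q (1, 0) + S₁ - M * e q) + ψ' * Ex * (c * e q + S₂) := by
        rw [h1, hsum, hWt, hWq]; ring
    _ ≤ 0 := add_nonpos hA hB

end Pointwise

end Literature.Analysis.FluidPDE
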